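import Summits.QuantumFields.BalabanUV.Beta.GAN24.KcompInverseUniform
import Summits.QuantumFields.BalabanUV.Beta.GAN24.ScalarSupLettersCubicHolds
import Summits.QuantumFields.BalabanUV.T4Continuum.Support.CTGaugeTerm

/-!
# G-an2-4 ∕ (CONV-C) — THE LITERAL [B5] (1.126)-SHAPE KERNEL BOUND FOR THE TYPED GAUGE TERM `∂·P·∂ᴴ = GradOp·PcT·GradOpᴴ`
# ON CUBIC TORI: `|(∂P∂ᴴ)((x,μ),(x″,ν))| ≤ C·n^{−(d+1)}·e^{−δ·|blk x − blk x″|_{T₁}}`, UNIFORMLY IN `n = η⁻¹`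

G-an2-4 formalisation swarm `b2b-balaban-gan24-formalise-*`, leaf prover 01 (gen 56), crux team (2) under the coordinator ruling
«YM REDIRECT» (e34b3e0c).  INTENT «DPD-LIT» (journal l.30179), FILE B of two.  The object is B5's (1.26)∕(1.70) projection
`PcT n M n = Δ⁻¹Q′ᴴ(Q′Δ⁻²Q′ᴴ)⁻¹Q′Δ⁻¹` (`B5Value126.PcT`, a-free) sandwiched by the gradient `GradOp (fine n M) n` of (1.4) — the
non-local `−∂P∂*` term of `B5DeltaA169.DeltaA` (1.69).  Its counting-measure entries are bounded here by `C·η^{d+1}·e^{−δ|y−y″|}`,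
`C, δ` depending on `d` only (through `a′ := 1`), for every `n ≥ 1` and every CUBIC unit torus `M = fun _ => N₀` — the shape of
binder (K) of `GAN24/Entry110LapReduction.entry110Lap_one_of_kernel_decay` (leaf-01 gen 54, p253408) at cubic `M`, and the kernel
letter of the `∂PcT∂*` term of road P2's vector one-step law (gan24-p2 gen 29: «located extra work»).

ROAD ([folklore] linear algebra over TREE theorems BY NAME): the substrate's `CTGaugeTerm.gaugeTerm_eq_factor` (⇐ NE2 leaf-09's
`ScalarGaugeProjectionUnit.Pone_eq : Pone = PcT + Pker`, the typed «(1.26) = (1.70) + constants») gives `∂·PcT·∂ᴴ = X·Kcomp⁻¹·Xᴴ`,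
`X = Xp n M 1 = ∂·G′·Q̃′ᴴ`, `Q̃′ = √(n^{d+1})·Q′`.  §1 generic coarse-torus estimate `norm_XKXH_apply_le` (localised `X`, `K′` ⇒ localised
`X·K′·Xᴴ`; two torus convolutions `EffectiveKernel.sum_exp_ldist_le`, volume-free); §2 `|X((x,μ), y)| ≤ Cst·(√(n^{d+1}))⁻¹·e^{−δ|blk x − y|}`
from a localized block-row letter for `∂_μ·G′` — on CUBIC tori leaf-06-g35's `ScalarSupLettersCubicHolds.scalarRowDecay_cubic` conj. 3 (the
ONE cubic-only input); §3 `norm_gaugeTerm_apply_le_of_letters` (ANY torus, given that letter there), `gaugeTerm_kernel_of_gradLetter` (binder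
(K) of p253408 ∀ `M` MODULO that one every-torus letter — the exact residual debt), ENDs **`gaugeTerm_kernel_cubic`** (blockOf ∕ rep) and
**`gaugeTerm_kernel_cubic_bpt`** ((K)'s `bpt ∕ toT` currency), with FILE A's `KcompInverseUniform.kcomp_inv_decay`; §4 road P2's currencies
on cubic tori: `gaugeTerm_rowDecay_cubic` (`BlockFieldDecay.RowDecay`) and the sup → sup letter `gaugeTerm_sup_cubic`.

HONEST SCOPE.  `U = 1`; CUBIC tori `M = fun _ : Fin (d+1) => N₀`, every `N₀ ≥ 1`, every `n ≥ 1`; constants existential in `d` (they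
inherit (L0)'s and the (α) chain's).  OUR estimate, [folklore]-grade; nothing printed is asserted — [B5] `Balaban1984PropagatorsI`
p. 38 (1.126) «|(∂P∂*)_{μν}(x,x′)| ≦ O(1)e^{−δ′₀|x−x′|}», «the constant O(1) depends on d only» is a TEXT LOCATION (pv15's
`B5DPD126Uniform.matrixP_decay_uniform` certifies the multiplier MODEL on every torus; this file is the LITERAL `PcT`, cubic).  The
∀-torus binder (K) of p253408 is NOT discharged (cubic input).  No `def`, no `def … : Prop`, no `sorry`.  Discharges no binder of
(CONV-C) as typed; NOT (CONV-C), NEVER «G-an2-4 closed», NOT NE2 ∕ NE3, NOT D1, NOT BetaPertH, NOT continuum, NOT Clay; not in print —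
our bookkeeping.  ABSOLUTE RULE of the cell kept.
HONEST DEPENDENCY: continuum YM on T⁴ ⇐ BetaPertH ∧ nine spine estimates (0/9 proved); BetaPertH ⇐ (D1) ∧ (D4) ∧ CAP+tail; G-an2-4
gates asym, D1 and NE2/3/4.
-/

noncomputable section

open scoped BigOperators ComplexConjugate Matrix ComplexOrder
open Finset

namespace Summit.QuantumFields.BalabanUV.Beta.GAN24.GaugeTermKernelCubic

open Literature.MathematicalPhysics.QuantumFieldTheory.Balaban1983to89
open B5Prop11Plancherel (Tor fine)
open B5Action121 (sdiff GradOp)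
open B5Block118 (bpt QsOp)
open B5Blocks16 (blockOf blockOf_bpt sum_blocks)
open B5Value126 (PcT)
open B4TorusKernel.MultiPeriod (torusSupNorm torusSupNorm_nonneg)
open B4Sect5Proof (latticeConst latticeConst_nonneg)
open B6LowerBound2153Torus (toT rep toT_rep)
open Beta.TorusG0Decay (ldist ldist_self ldist_symm ldist_triangle)
open Beta.EffectiveKernel (sum_exp_ldist_le)
open Summit.QuantumFields.BalabanUV.T4Continuum
open Summit.QuantumFields.BalabanUV.T4Continuum.ScalarBlockPoincare (QsOp_apply_blockOf)
open Summit.QuantumFields.BalabanUV.T4Continuum.ScalarAveragedPropagator (Gps)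
open Summit.QuantumFields.BalabanUV.T4Continuum.ScalarAveragedCompression (Kcomp Qiso)
open Summit.QuantumFields.BalabanUV.T4Continuum.CTGaugeTerm (Xp Xp_conjTranspose gaugeTerm_eq_factor)
open Summit.QuantumFields.BalabanUV.Beta.GAN24.Entry110GradCubic (torusSupNorm_rep_toT_sub_rep_toT)
open Summit.QuantumFields.BalabanUV.Beta.GAN24.ScalarSupLettersCubicHolds (scalarRowDecay_cubic)
open Summit.QuantumFields.BalabanUV.Beta.GAN24.SavgInverseUniform (ldist_nonneg ldist_eq_torusSupNorm latticeConst_pos_of_pos)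
open Summit.QuantumFields.BalabanUV.Beta.GAN24.BlockFieldDecay (RowDecay)
open Summit.QuantumFields.BalabanUV.Beta.GAN24.KcompInverseUniform (exp_split kcomp_inv_decay)

variable {d : ℕ}
/-! ## §1 A generic coarse-torus estimate: `X·K′·Xᴴ` with localised factors -/
section Triple
variable (M : Fin (d + 1) → ℕ) [hM : ∀ μ, NeZero (M μ)] {ι : Type*}
/-- one torus convolution: `Σ_y e^{−δ₁|b − y|}·e^{−δ₂|y − b′|} ≤ K_{d+1}(δ∕2)·e^{−(δ∕2)|b − b′|}`, `δ = min δ₁ δ₂`. [folklore] -/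
theorem sum_exp_exp_le {δ₁ δ₂ : ℝ} (hδ₁ : 0 < δ₁) (hδ₂ : 0 < δ₂) (b b' : Tor M) :
    ∑ y, Real.exp (-(δ₁ * ldist M b y)) * Real.exp (-(δ₂ * ldist M y b'))
      ≤ latticeConst (d + 1) (min δ₁ δ₂ / 2) * Real.exp (-(min δ₁ δ₂ / 2 * ldist M b b')) := by
  set δ := min δ₁ δ₂ with hδdef
  have hδ : 0 < δ := lt_min hδ₁ hδ₂
  have hle1 : δ ≤ δ₁ := min_le_left _ _
  have hle2 : δ ≤ δ₂ := min_le_right _ _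
  calc ∑ y, Real.exp (-(δ₁ * ldist M b y)) * Real.exp (-(δ₂ * ldist M y b'))
      ≤ ∑ y, Real.exp (-(δ * ldist M b y)) * Real.exp (-(δ * ldist M y b')) := by
        refine Finset.sum_le_sum fun y _ => mul_le_mul ?_ ?_ (Real.exp_pos _).le (Real.exp_pos _).le
        · exact Real.exp_le_exp.mpr (by nlinarith [ldist_nonneg M b y])
        · exact Real.exp_le_exp.mpr (by nlinarith [ldist_nonneg M y b'])
    _ ≤ ∑ y, Real.exp (-(δ / 2 * ldist M b b')) * Real.exp (-(δ / 2 * ldist M b y)) :=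
        Finset.sum_le_sum fun y _ => exp_split hδ.le (ldist_nonneg M y b') (ldist_triangle M b y b')
    _ = Real.exp (-(δ / 2 * ldist M b b')) * ∑ y, Real.exp (-(δ / 2 * ldist M b y)) := by rw [Finset.mul_sum]
    _ ≤ Real.exp (-(δ / 2 * ldist M b b')) * latticeConst (d + 1) (δ / 2) :=
        mul_le_mul_of_nonneg_left (sum_exp_ldist_le M b (half_pos hδ)) (Real.exp_pos _).le
    _ = latticeConst (d + 1) (δ / 2) * Real.exp (-(δ / 2 * ldist M b b')) := mul_comm _ _

/-- **`|(X·K′·Xᴴ)(i, i″)| ≤ c²·σ·K_{d+1}(δ∕2)·K_{d+1}(δ′∕2)·e^{−(δ′∕2)|β i − β i″|}`** for localised `X` (rate `δ₁` from the block map `β`)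
and `K′` (rate `δ₂`), where `δ = min δ₁ δ₂`, `δ′ = min δ₁ (δ∕2)` — the two sums run over the COARSE torus only, so nothing depends on
the fine lattice or on the volume. [folklore] -/
theorem norm_XKXH_apply_le (X : Matrix ι (Tor M) ℂ) (K' : Matrix (Tor M) (Tor M) ℂ) (β : ι → Tor M) {c σ δ₁ δ₂ : ℝ}
    (hc : 0 ≤ c) (hσ : 0 ≤ σ) (hδ₁ : 0 < δ₁) (hδ₂ : 0 < δ₂)
    (hX : ∀ i y, ‖X i y‖ ≤ c * Real.exp (-(δ₁ * ldist M (β i) y)))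
    (hK : ∀ y y', ‖K' y y'‖ ≤ σ * Real.exp (-(δ₂ * ldist M y y'))) (i i'' : ι) :
    ‖(X * K' * Xᴴ) i i''‖
      ≤ c ^ 2 * σ * latticeConst (d + 1) (min δ₁ δ₂ / 2) * latticeConst (d + 1) (min δ₁ (min δ₁ δ₂ / 2) / 2)
          * Real.exp (-(min δ₁ (min δ₁ δ₂ / 2) / 2 * ldist M (β i) (β i''))) := by
  set δ := min δ₁ δ₂ with hδdef
  have hδ : 0 < δ := lt_min hδ₁ hδ₂
  set δ' := min δ₁ (δ / 2) with hδ'def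
  have hδ' : 0 < δ' := lt_min hδ₁ (half_pos hδ)
  -- the inner factor `(X·K′)(i, y′)`
  have hXK : ∀ y', ‖(X * K') i y'‖ ≤ c * σ * latticeConst (d + 1) (δ / 2) * Real.exp (-(δ / 2 * ldist M (β i) y')) := by
    intro y'
    rw [Matrix.mul_apply]
    calc ‖∑ y, X i y * K' y y'‖ ≤ ∑ y, ‖X i y‖ * ‖K' y y'‖ := by
          refine (norm_sum_le _ _).trans (Finset.sum_le_sum fun y _ => ?_); rw [norm_mul]
      _ ≤ ∑ y, c * Real.exp (-(δ₁ * ldist M (β i) y)) * (σ * Real.exp (-(δ₂ * ldist M y y'))) :=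
          Finset.sum_le_sum fun y _ => mul_le_mul (hX i y) (hK y y') (norm_nonneg _) (by positivity)
      _ = c * σ * ∑ y, Real.exp (-(δ₁ * ldist M (β i) y)) * Real.exp (-(δ₂ * ldist M y y')) := by
          rw [Finset.mul_sum]; refine Finset.sum_congr rfl fun y _ => ?_; ring
      _ ≤ c * σ * (latticeConst (d + 1) (δ / 2) * Real.exp (-(δ / 2 * ldist M (β i) y'))) :=
          mul_le_mul_of_nonneg_left (sum_exp_exp_le M hδ₁ hδ₂ (β i) y') (by positivity)
      _ = _ := by ring
  -- the outer sum against `Xᴴ(y′, i″) = conj X(i″, y′)`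
  rw [Matrix.mul_apply]
  have hL : 0 ≤ latticeConst (d + 1) (δ / 2) := latticeConst_nonneg _ (half_pos hδ).le
  calc ‖∑ y', (X * K') i y' * Xᴴ y' i''‖ ≤ ∑ y', ‖(X * K') i y'‖ * ‖X i'' y'‖ := by
        refine (norm_sum_le _ _).trans (Finset.sum_le_sum fun y' _ => ?_)
        rw [norm_mul, Matrix.conjTranspose_apply, norm_star]
    _ ≤ ∑ y', c * σ * latticeConst (d + 1) (δ / 2) * Real.exp (-(δ / 2 * ldist M (β i) y'))
          * (c * Real.exp (-(δ₁ * ldist M (β i'') y'))) :=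
        Finset.sum_le_sum fun y' _ => mul_le_mul (hXK y') (hX i'' y') (norm_nonneg _) (by positivity)
    _ = c ^ 2 * σ * latticeConst (d + 1) (δ / 2)
          * ∑ y', Real.exp (-(δ / 2 * ldist M (β i) y')) * Real.exp (-(δ₁ * ldist M y' (β i''))) := by
        rw [Finset.mul_sum]; refine Finset.sum_congr rfl fun y' _ => ?_; rw [ldist_symm M y' (β i'')]; ring
    _ ≤ c ^ 2 * σ * latticeConst (d + 1) (δ / 2)
          * (latticeConst (d + 1) (min (δ / 2) δ₁ / 2) * Real.exp (-(min (δ / 2) δ₁ / 2 * ldist M (β i) (β i'')))) :=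
        mul_le_mul_of_nonneg_left (sum_exp_exp_le M (half_pos hδ) hδ₁ (β i) (β i'')) (by positivity)
    _ = _ := by rw [min_comm (δ / 2) δ₁]; ring
end Triple

/-! ## §2 The factor `X = ∂·G′·Q̃′ᴴ`: entries from the localized `∂·G′` letter -/
section Factor
variable (n : ℕ) [NeZero n] (M : Fin (d + 1) → ℕ) [hM : ∀ μ, NeZero (M μ)]
/-- `X((x,μ), y) = √(n^{d+1})·n^{−(d+1)}·Σ_{x′ ∈ B(y)} (∂_μ·G′)(x, x′)`. [folklore] -/
theorem Xp_apply (a' : ℝ) (x : Tor (fine n M)) (μ : Fin (d + 1)) (y : Tor M) :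
    Xp n M a' (x, μ) y
      = ((Real.sqrt ((n : ℝ) ^ (d + 1)) : ℝ) : ℂ) * (1 / (n : ℂ) ^ (d + 1))
          * ∑ x', (if blockOf n M x' = y then (sdiff (fine n M) (n : ℂ) μ * Gps n M a') x x' else 0) := by
  have hGG : ∀ x', (GradOp (fine n M) ((n : ℕ) : ℂ) * Gps n M a') (x, μ) x' = (sdiff (fine n M) (n : ℂ) μ * Gps n M a') x x' := by
    intro x'; simp only [Matrix.mul_apply, GradOp]
  rw [Xp, Matrix.mul_apply, Finset.mul_sum]
  refine Finset.sum_congr rfl fun x' _ => ?_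
  rw [hGG, Matrix.conjTranspose_apply, Qiso, Matrix.smul_apply, smul_eq_mul, star_mul', Complex.star_def, Complex.conj_ofReal,
    QsOp_apply_blockOf]
  split_ifs with h
  · rw [map_div₀, map_one, map_pow, Complex.conj_natCast]; ring
  · rw [map_zero]; ring

/-- **`|X((x,μ), y)| ≤ Cst·(√(n^{d+1}))⁻¹·e^{−δ|blk x − y|}`** from a localized block-row bound of `∂_μ·G′`. [folklore] -/
theorem norm_Xp_apply_le {a' Cst δ : ℝ}
    (hrow : ∀ (μ : Fin (d + 1)) (x : Tor (fine n M)) (y : Tor M),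
      (∑ x', (if blockOf n M x' = y then ‖(sdiff (fine n M) (n : ℂ) μ * Gps n M a') x x'‖ else 0))
        ≤ Cst * Real.exp (-(δ * torusSupNorm M (rep M (blockOf n M x) - rep M y))))
    (x : Tor (fine n M)) (μ : Fin (d + 1)) (y : Tor M) :
    ‖Xp n M a' (x, μ) y‖ ≤ Cst / Real.sqrt ((n : ℝ) ^ (d + 1)) * Real.exp (-(δ * ldist M (blockOf n M x) y)) := by
  have hn : (0 : ℝ) < (n : ℝ) ^ (d + 1) := pow_pos (Nat.cast_pos.mpr (NeZero.pos n)) _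
  have hs : 0 < Real.sqrt ((n : ℝ) ^ (d + 1)) := Real.sqrt_pos.mpr hn
  rw [Xp_apply, norm_mul, norm_mul, Complex.norm_real, Real.norm_of_nonneg hs.le, norm_div, norm_one, norm_pow,
    Complex.norm_natCast, ldist_eq_torusSupNorm]
  have h1 : ‖∑ x', (if blockOf n M x' = y then (sdiff (fine n M) (n : ℂ) μ * Gps n M a') x x' else 0)‖
      ≤ ∑ x', (if blockOf n M x' = y then ‖(sdiff (fine n M) (n : ℂ) μ * Gps n M a') x x'‖ else 0) := by
    refine (norm_sum_le _ _).trans (Finset.sum_le_sum fun x' _ => ?_)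
    split_ifs <;> simp
  have hsq : Real.sqrt ((n : ℝ) ^ (d + 1)) * (1 / (n : ℝ) ^ (d + 1)) = 1 / Real.sqrt ((n : ℝ) ^ (d + 1)) := by
    have e := Real.mul_self_sqrt hn.le
    field_simp
    linarith [e]
  calc Real.sqrt ((n : ℝ) ^ (d + 1)) * (1 / (n : ℝ) ^ (d + 1))
        * ‖∑ x', (if blockOf n M x' = y then (sdiff (fine n M) (n : ℂ) μ * Gps n M a') x x' else 0)‖
      ≤ Real.sqrt ((n : ℝ) ^ (d + 1)) * (1 / (n : ℝ) ^ (d + 1))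
          * (Cst * Real.exp (-(δ * torusSupNorm M (rep M (blockOf n M x) - rep M y)))) :=
        mul_le_mul_of_nonneg_left (h1.trans (hrow μ x y)) (by positivity)
    _ = Cst / Real.sqrt ((n : ℝ) ^ (d + 1)) * Real.exp (-(δ * torusSupNorm M (rep M (blockOf n M x) - rep M y))) := by
        rw [hsq]; ring
end Factor

/-! ## §3 Every torus, conditionally on the localized `∂·G′` letter; then the cubic ENDs -/
section General
variable (n : ℕ) [NeZero n] (M : Fin (d + 1) → ℕ) [hM : ∀ μ, NeZero (M μ)]
/-- **THE GAUGE-TERM KERNEL ON ANY TORUS, GIVEN the localized block-row letter of `∂_μ·G′` at `a′ = 1` on that torus** (constants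
`(Cst, δ₁)`) and the localisation of `Kcomp⁻¹` (constants `(σ, δ₂)`, FILE A):
`‖(GradOp·PcT·GradOpᴴ)((x,μ),(x″,ν))‖ ≤ (Cst²·σ·K_{d+1}(δ∕2)·K_{d+1}(δ′∕2))·n^{−(d+1)}·e^{−(δ′∕2)|blk x − blk x″|}`,
`δ = min δ₁ δ₂`, `δ′ = min δ₁ (δ∕2)`. [folklore] -/
theorem norm_gaugeTerm_apply_le_of_letters {Cst δ₁ σ δ₂ : ℝ} (hCst : 0 ≤ Cst) (hδ₁ : 0 < δ₁) (hσ : 0 ≤ σ) (hδ₂ : 0 < δ₂)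
    (hrow : ∀ (μ : Fin (d + 1)) (x : Tor (fine n M)) (y : Tor M),
      (∑ x', (if blockOf n M x' = y then ‖(sdiff (fine n M) (n : ℂ) μ * Gps n M 1) x x'‖ else 0))
        ≤ Cst * Real.exp (-(δ₁ * torusSupNorm M (rep M (blockOf n M x) - rep M y))))
    (hK : ∀ y y' : Tor M, ‖(Kcomp n M 1)⁻¹ y y'‖ ≤ σ * Real.exp (-(δ₂ * torusSupNorm M (rep M y - rep M y'))))
    (μ ν : Fin (d + 1)) (x x'' : Tor (fine n M)) :
    ‖(GradOp (fine n M) (n : ℂ) * PcT n M (n : ℂ) * (GradOp (fine n M) (n : ℂ))ᴴ) (x, μ) (x'', ν)‖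
      ≤ Cst ^ 2 * σ * latticeConst (d + 1) (min δ₁ δ₂ / 2) * latticeConst (d + 1) (min δ₁ (min δ₁ δ₂ / 2) / 2)
          / (n : ℝ) ^ (d + 1)
        * Real.exp (-(min δ₁ (min δ₁ δ₂ / 2) / 2 * torusSupNorm M (rep M (blockOf n M x) - rep M (blockOf n M x'')))) := by
  have hnr : (0 : ℝ) < (n : ℝ) ^ (d + 1) := pow_pos (Nat.cast_pos.mpr (NeZero.pos n)) _
  have hX : ∀ (i : Tor (fine n M) × Fin (d + 1)) (y : Tor M),
      ‖Xp n M 1 i y‖ ≤ Cst / Real.sqrt ((n : ℝ) ^ (d + 1)) * Real.exp (-(δ₁ * ldist M (blockOf n M i.1) y)) :=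
    fun i y => norm_Xp_apply_le n M hrow i.1 i.2 y
  have hK' : ∀ y y' : Tor M, ‖(Kcomp n M 1)⁻¹ y y'‖ ≤ σ * Real.exp (-(δ₂ * ldist M y y')) := by
    intro y y'; rw [ldist_eq_torusSupNorm]; exact hK y y'
  have h := norm_XKXH_apply_le M (Xp n M 1) ((Kcomp n M 1)⁻¹) (fun i => blockOf n M i.1) (by positivity) hσ hδ₁ hδ₂ hX hK'
    (x, μ) (x'', ν)
  rw [gaugeTerm_eq_factor n M one_pos]
  refine h.trans (le_of_eq ?_)
  rw [ldist_eq_torusSupNorm, div_pow, Real.sq_sqrt hnr.le]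
  ring


variable (d) in
/-- **EVERY TORUS, MODULO ONE LETTER — binder (K) of `Entry110LapReduction.entry110Lap_one_of_kernel_decay` (p253408) in its own ∀-`M`
`bpt ∕ toT` currency**, from an every-torus localized block-row letter for `∂_μ·G′` at `a′ = 1` (hypothesis `hα`; in the tree only on CUBIC
tori, `ScalarSupLettersCubicHolds.scalarRowDecay_cubic`) and FILE A's `kcomp_inv_decay` (every torus, no hypothesis).  Records exactly what the
∀-torus discharge of (K) still needs. [folklore] -/
theorem gaugeTerm_kernel_of_gradLetter
    (hα : ∃ Cst δ₁ : ℝ, 0 < Cst ∧ 0 < δ₁ ∧ ∀ (n : ℕ) (M : Fin (d + 1) → ℕ) [NeZero n] [∀ μ, NeZero (M μ)], 1 ≤ n →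
      ∀ (μ : Fin (d + 1)) (x : Tor (fine n M)) (y : Tor M),
        (∑ x', (if blockOf n M x' = y then ‖(sdiff (fine n M) (n : ℂ) μ * Gps n M 1) x x'‖ else 0))
          ≤ Cst * Real.exp (-(δ₁ * torusSupNorm M (rep M (blockOf n M x) - rep M y)))) :
    ∃ δ C : ℝ, 0 < δ ∧ 0 < C ∧
      ∀ (n : ℕ) (M : Fin (d + 1) → ℕ) [NeZero n] [∀ μ, NeZero (M μ)], 1 ≤ n →
        ∀ (y y'' : Fin (d + 1) → ℤ) (r r'' : Fin (d + 1) → Fin n) (μ ν : Fin (d + 1)),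
          ‖(GradOp (fine n M) (n : ℂ) * PcT n M (n : ℂ) * (GradOp (fine n M) (n : ℂ))ᴴ)
              (bpt n M (toT M y) r, μ) (bpt n M (toT M y'') r'', ν)‖
            ≤ C / (n : ℝ) ^ (d + 1) * Real.exp (-(δ * torusSupNorm M (y - y''))) := by
  obtain ⟨Cst, δ₁, hCst, hδ₁, hα⟩ := hα
  obtain ⟨σ, δ₂, hσ, hδ₂, hK⟩ := kcomp_inv_decay d one_pos
  have hδ : 0 < min δ₁ δ₂ := lt_min hδ₁ hδ₂
  have hδ' : 0 < min δ₁ (min δ₁ δ₂ / 2) := lt_min hδ₁ (half_pos hδ)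
  have hL1 : 0 < latticeConst (d + 1) (min δ₁ δ₂ / 2) := latticeConst_pos_of_pos (Nat.succ_pos d) (half_pos hδ)
  have hL2 : 0 < latticeConst (d + 1) (min δ₁ (min δ₁ δ₂ / 2) / 2) :=
    latticeConst_pos_of_pos (Nat.succ_pos d) (half_pos hδ')
  refine ⟨min δ₁ (min δ₁ δ₂ / 2) / 2,
    Cst ^ 2 * σ * latticeConst (d + 1) (min δ₁ δ₂ / 2) * latticeConst (d + 1) (min δ₁ (min δ₁ δ₂ / 2) / 2),
    half_pos hδ', by positivity, ?_⟩
  intro n M _ _ hn y y'' r r'' μ ν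
  have h := norm_gaugeTerm_apply_le_of_letters n M hCst.le hδ₁ hσ.le hδ₂ (hα n M hn) (hK n M) μ ν
    (bpt n M (toT M y) r) (bpt n M (toT M y'') r'')
  rwa [blockOf_bpt, blockOf_bpt, torusSupNorm_rep_toT_sub_rep_toT] at h
end General

section End
variable (d)
/-- **END — THE GAUGE-TERM KERNEL ON CUBIC TORI, UNIFORMLY IN `n`**: there are `δ, C > 0` (depending on `d` only) such that for every
`n ≥ 1`, every `N₀ ≥ 1`, all `μ ν x x″`, on the cubic unit torus `M = fun _ => N₀`,
`‖(GradOp·PcT n M n·GradOpᴴ)((x,μ),(x″,ν))‖ ≤ C·n^{−(d+1)}·e^{−δ·|rep(blk x) − rep(blk x″)|_{T,∞}}`.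
Inputs BY NAME: `CTGaugeTerm.gaugeTerm_eq_factor` (a′ = 1), `KcompInverseUniform.kcomp_inv_decay`, `scalarRowDecay_cubic`.
OUR estimate; [B5] p. 38 (1.126) is a text location. [folklore] -/
theorem gaugeTerm_kernel_cubic :
    ∃ δ C : ℝ, 0 < δ ∧ 0 < C ∧ ∀ (n N₀ : ℕ) [NeZero n] [NeZero N₀], 1 ≤ n →
      ∀ (μ ν : Fin (d + 1)) (x x'' : Tor (fine n (fun _ : Fin (d + 1) => N₀))),
        ‖(GradOp (fine n (fun _ : Fin (d + 1) => N₀)) (n : ℂ) * PcT n (fun _ : Fin (d + 1) => N₀) (n : ℂ)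
            * (GradOp (fine n (fun _ : Fin (d + 1) => N₀)) (n : ℂ))ᴴ) (x, μ) (x'', ν)‖
          ≤ C / (n : ℝ) ^ (d + 1) * Real.exp (-(δ * torusSupNorm (fun _ : Fin (d + 1) => N₀)
              (rep (fun _ : Fin (d + 1) => N₀) (blockOf n (fun _ : Fin (d + 1) => N₀) x)
                - rep (fun _ : Fin (d + 1) => N₀) (blockOf n (fun _ : Fin (d + 1) => N₀) x'')))) := by
  obtain ⟨Cst, δ₁, hCst, hδ₁, hα⟩ := scalarRowDecay_cubic (d := d) one_pos
  obtain ⟨σ, δ₂, hσ, hδ₂, hK⟩ := kcomp_inv_decay d one_pos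
  have hδ : 0 < min δ₁ δ₂ := lt_min hδ₁ hδ₂
  have hδ' : 0 < min δ₁ (min δ₁ δ₂ / 2) := lt_min hδ₁ (half_pos hδ)
  have hL1 : 0 < latticeConst (d + 1) (min δ₁ δ₂ / 2) := latticeConst_pos_of_pos (Nat.succ_pos d) (half_pos hδ)
  have hL2 : 0 < latticeConst (d + 1) (min δ₁ (min δ₁ δ₂ / 2) / 2) :=
    latticeConst_pos_of_pos (Nat.succ_pos d) (half_pos hδ')
  refine ⟨min δ₁ (min δ₁ δ₂ / 2) / 2,
    Cst ^ 2 * σ * latticeConst (d + 1) (min δ₁ δ₂ / 2) * latticeConst (d + 1) (min δ₁ (min δ₁ δ₂ / 2) / 2),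
    half_pos hδ', by positivity, ?_⟩
  intro n N₀ _ _ hn μ ν x x''
  exact norm_gaugeTerm_apply_le_of_letters n (fun _ : Fin (d + 1) => N₀) hCst.le hδ₁ hσ.le hδ₂
    (fun μ' x' y' => (hα n N₀ hn μ' μ' x' y').2.2.1) (hK n (fun _ : Fin (d + 1) => N₀)) μ ν x x''

/-- **THE SAME IN THE `bpt ∕ toT` CURRENCY OF BINDER (K)** of `Entry110LapReduction.entry110Lap_one_of_kernel_decay` (p253408), at
cubic `M`: for `x = n·ȳ + r`, `x″ = n·ȳ″ + r″`, `‖(∂P∂ᴴ)((x,μ),(x″,ν))‖ ≤ C·n^{−(d+1)}·e^{−δ·|y − y″|_{T,∞}}`.  (The ∀-torus binder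
of p253408 is NOT discharged by this cubic statement.) [folklore] -/
theorem gaugeTerm_kernel_cubic_bpt :
    ∃ δ C : ℝ, 0 < δ ∧ 0 < C ∧ ∀ (n N₀ : ℕ) [NeZero n] [NeZero N₀], 1 ≤ n →
      ∀ (y y'' : Fin (d + 1) → ℤ) (r r'' : Fin (d + 1) → Fin n) (μ ν : Fin (d + 1)),
        ‖(GradOp (fine n (fun _ : Fin (d + 1) => N₀)) (n : ℂ) * PcT n (fun _ : Fin (d + 1) => N₀) (n : ℂ)
            * (GradOp (fine n (fun _ : Fin (d + 1) => N₀)) (n : ℂ))ᴴ)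
            (bpt n (fun _ : Fin (d + 1) => N₀) (toT (fun _ : Fin (d + 1) => N₀) y) r, μ)
            (bpt n (fun _ : Fin (d + 1) => N₀) (toT (fun _ : Fin (d + 1) => N₀) y'') r'', ν)‖
          ≤ C / (n : ℝ) ^ (d + 1) * Real.exp (-(δ * torusSupNorm (fun _ : Fin (d + 1) => N₀) (y - y''))) := by
  obtain ⟨δ, C, hδ, hC, h⟩ := gaugeTerm_kernel_cubic d
  refine ⟨δ, C, hδ, hC, fun n N₀ _ _ hn y y'' r r'' μ ν => ?_⟩
  have h1 := h n N₀ hn μ ν (bpt n (fun _ : Fin (d + 1) => N₀) (toT (fun _ : Fin (d + 1) => N₀) y) r)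
    (bpt n (fun _ : Fin (d + 1) => N₀) (toT (fun _ : Fin (d + 1) => N₀) y'') r'')
  rwa [blockOf_bpt, blockOf_bpt, torusSupNorm_rep_toT_sub_rep_toT] at h1
end End

/-! ## §4 Road P2's currencies: per-block row decay (`BlockFieldDecay.RowDecay`) and the sup → sup letter -/
section Generic
variable (n : ℕ) [NeZero n] (M : Fin (d + 1) → ℕ) [hM : ∀ μ, NeZero (M μ)]
/-- [folklore] **entrywise `C·n^{−(d+1)}·e^{−δ|blk · − blk ·|}` ⇒ per-block row decay with constant `(d+1)·C`**, for any kernel on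
`T_η × {directions}`: the `n^{d+1}` fine sites of a block against the entries' `n^{−(d+1)}`. -/
theorem rowDecay_of_entry_le (A : Matrix (Tor (fine n M) × Fin (d + 1)) (Tor (fine n M) × Fin (d + 1)) ℂ) {C δ : ℝ}
    (h : ∀ (μ ν : Fin (d + 1)) (x x'' : Tor (fine n M)),
      ‖A (x, μ) (x'', ν)‖ ≤ C / (n : ℝ) ^ (d + 1)
        * Real.exp (-(δ * torusSupNorm M (rep M (blockOf n M x) - rep M (blockOf n M x''))))) :
    RowDecay M (fun i : Tor (fine n M) × Fin (d + 1) => blockOf n M i.1) (fun i => blockOf n M i.1) A ((d + 1) * C) δ := by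
  intro i y''
  obtain ⟨x, μ⟩ := i
  have hnr : (0 : ℝ) < (n : ℝ) ^ (d + 1) := pow_pos (Nat.cast_pos.mpr (NeZero.pos n)) _
  have hent : ∀ (x'' : Tor (fine n M)) (ν : Fin (d + 1)), blockOf n M x'' = y'' →
      ‖A (x, μ) (x'', ν)‖ ≤ C / (n : ℝ) ^ (d + 1) * Real.exp (-(δ * torusSupNorm M (rep M (blockOf n M x) - rep M y''))) := by
    intro x'' ν hx
    have h1 := h μ ν x x''
    rwa [hx] at h1
  rw [Fintype.sum_prod_type]
  calc ∑ x'' : Tor (fine n M), ∑ ν : Fin (d + 1), (if blockOf n M (x'', ν).1 = y'' then ‖A (x, μ) (x'', ν)‖ else 0)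
      = ∑ z : Tor M, ∑ j : Fin (d + 1) → Fin n, ∑ ν : Fin (d + 1),
          (if blockOf n M (bpt n M z j) = y'' then ‖A (x, μ) (bpt n M z j, ν)‖ else 0) := by
        have := sum_blocks n M (fun x'' => ((∑ ν : Fin (d + 1), (if blockOf n M x'' = y'' then ‖A (x, μ) (x'', ν)‖ else 0) : ℝ) : ℂ))
        exact_mod_cast this
    _ = ∑ j : Fin (d + 1) → Fin n, ∑ ν : Fin (d + 1), ‖A (x, μ) (bpt n M y'' j, ν)‖ := by
        rw [Finset.sum_eq_single y'' (fun z _ hz => by simp [blockOf_bpt, hz]) (fun hy => absurd (Finset.mem_univ _) hy)]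
        simp [blockOf_bpt]
    _ ≤ ∑ _j : Fin (d + 1) → Fin n, ∑ _ν : Fin (d + 1),
          C / (n : ℝ) ^ (d + 1) * Real.exp (-(δ * torusSupNorm M (rep M (blockOf n M x) - rep M y''))) :=
        Finset.sum_le_sum fun j _ => Finset.sum_le_sum fun ν _ => hent _ _ (blockOf_bpt n M y'' j)
    _ = (d + 1) * C * Real.exp (-(δ * torusSupNorm M (rep M (blockOf n M x) - rep M y''))) := by
        simp only [Finset.sum_const, Finset.card_univ, Fintype.card_fin]
        rw [Fintype.card_pi, Finset.prod_const, Fintype.card_fin, Finset.card_univ, Fintype.card_fin]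
        simp only [nsmul_eq_mul]
        push_cast
        field_simp

/-- [folklore] **per-block row decay ⇒ sup → sup**: `‖(A J)(i)‖ ≤ C·K_{d+1}(δ)·‖J‖_∞` (block resummation over the unit torus,
`EffectiveKernel.sum_exp_ldist_le`; volume-free). -/
theorem norm_mulVec_le_of_rowDecay' (A : Matrix (Tor (fine n M) × Fin (d + 1)) (Tor (fine n M) × Fin (d + 1)) ℂ) {C δ : ℝ}
    (hδ : 0 < δ) (h : RowDecay M (fun i : Tor (fine n M) × Fin (d + 1) => blockOf n M i.1) (fun i => blockOf n M i.1) A C δ)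
    (J : Tor (fine n M) × Fin (d + 1) → ℂ) (b : ℝ) (hJ : ∀ j, ‖J j‖ ≤ b) (i : Tor (fine n M) × Fin (d + 1)) :
    ‖(A *ᵥ J) i‖ ≤ C * latticeConst (d + 1) δ * b := by
  have hb : 0 ≤ b := (norm_nonneg _).trans (hJ i)
  have hrow := h i
  have hC : 0 ≤ C := by
    have h0 : (0 : ℝ) ≤ ∑ x', (if blockOf n M x'.1 = blockOf n M i.1 then ‖A i x'‖ else 0) :=
      Finset.sum_nonneg fun x' _ => by split_ifs <;> simp
    have h1 := h0.trans (hrow (blockOf n M i.1))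
    rwa [sub_self, T4EtaRateOperatorTorus.torusSupNorm_zero, mul_zero, neg_zero, Real.exp_zero, mul_one] at h1
  have hsplit : ∑ x'', ‖A i x''‖ = ∑ y'' : Tor M, ∑ x'', (if blockOf n M x''.1 = y'' then ‖A i x''‖ else 0) := by
    rw [Finset.sum_comm]
    refine Finset.sum_congr rfl fun x'' _ => ?_
    rw [Finset.sum_ite_eq, if_pos (Finset.mem_univ _)]
  rw [Matrix.mulVec, dotProduct]
  calc ‖∑ x'', A i x'' * J x''‖ ≤ ∑ x'', ‖A i x''‖ * ‖J x''‖ := by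
        refine (norm_sum_le _ _).trans (Finset.sum_le_sum fun x'' _ => ?_); rw [norm_mul]
    _ ≤ ∑ x'', ‖A i x''‖ * b := Finset.sum_le_sum fun x'' _ => mul_le_mul_of_nonneg_left (hJ x'') (norm_nonneg _)
    _ = (∑ y'' : Tor M, ∑ x'', (if blockOf n M x''.1 = y'' then ‖A i x''‖ else 0)) * b := by rw [← Finset.sum_mul, hsplit]
    _ ≤ (∑ y'' : Tor M, C * Real.exp (-(δ * torusSupNorm M (rep M (blockOf n M i.1) - rep M y'')))) * b :=
        mul_le_mul_of_nonneg_right (Finset.sum_le_sum fun y'' _ => hrow y'') hb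
    _ = C * b * ∑ y'' : Tor M, Real.exp (-(δ * ldist M (blockOf n M i.1) y'')) := by
        simp only [Finset.mul_sum, Finset.sum_mul]
        refine Finset.sum_congr rfl fun y'' _ => ?_
        rw [ldist_eq_torusSupNorm]; ring
    _ ≤ C * b * latticeConst (d + 1) δ := mul_le_mul_of_nonneg_left (sum_exp_ldist_le M _ hδ) (mul_nonneg hC hb)
    _ = C * latticeConst (d + 1) δ * b := by ring
end Generic

section Currencies
variable (d)
/-- **THE GAUGE-TERM KERNEL IN `RowDecay` CURRENCY, CUBIC TORI**: `Σ_{(x″,ν) : blk x″ = y″} ‖(∂P∂ᴴ)((x,μ),(x″,ν))‖ ≤ C·e^{−δ|blk x − y″|}`,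
constant and rate depending on `d` only. [folklore] -/
theorem gaugeTerm_rowDecay_cubic :
    ∃ C δ : ℝ, 0 < C ∧ 0 < δ ∧ ∀ (n N₀ : ℕ) [NeZero n] [NeZero N₀], 1 ≤ n →
      RowDecay (fun _ : Fin (d + 1) => N₀)
        (fun i : Tor (fine n (fun _ : Fin (d + 1) => N₀)) × Fin (d + 1) => blockOf n (fun _ : Fin (d + 1) => N₀) i.1)
        (fun i : Tor (fine n (fun _ : Fin (d + 1) => N₀)) × Fin (d + 1) => blockOf n (fun _ : Fin (d + 1) => N₀) i.1)
        (GradOp (fine n (fun _ : Fin (d + 1) => N₀)) (n : ℂ) * PcT n (fun _ : Fin (d + 1) => N₀) (n : ℂ)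
            * (GradOp (fine n (fun _ : Fin (d + 1) => N₀)) (n : ℂ))ᴴ) C δ := by
  obtain ⟨δ, C, hδ, hC, h⟩ := gaugeTerm_kernel_cubic d
  refine ⟨(d + 1) * C, δ, by positivity, hδ, fun n N₀ _ _ hn => ?_⟩
  exact rowDecay_of_entry_le n (fun _ : Fin (d + 1) => N₀) _ (h n N₀ hn)

/-- **THE SUP → SUP LETTER OF THE GAUGE TERM, CUBIC TORI, n-UNIFORM**: `‖(∂P∂ᴴ J)(x,μ)‖ ≤ C·‖J‖_∞` with `C` depending on `d` only.
[folklore] -/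
theorem gaugeTerm_sup_cubic :
    ∃ C : ℝ, 0 < C ∧ ∀ (n N₀ : ℕ) [NeZero n] [NeZero N₀], 1 ≤ n →
      ∀ (J : Tor (fine n (fun _ : Fin (d + 1) => N₀)) × Fin (d + 1) → ℂ) (b : ℝ), (∀ j, ‖J j‖ ≤ b) →
        ∀ i, ‖((GradOp (fine n (fun _ : Fin (d + 1) => N₀)) (n : ℂ) * PcT n (fun _ : Fin (d + 1) => N₀) (n : ℂ)
            * (GradOp (fine n (fun _ : Fin (d + 1) => N₀)) (n : ℂ))ᴴ) *ᵥ J) i‖ ≤ C * b := by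
  obtain ⟨C, δ, hC, hδ, h⟩ := gaugeTerm_rowDecay_cubic d
  refine ⟨C * latticeConst (d + 1) δ, mul_pos hC (latticeConst_pos_of_pos (Nat.succ_pos d) hδ), ?_⟩
  intro n N₀ _ _ hn J b hJ i
  exact norm_mulVec_le_of_rowDecay' n (fun _ : Fin (d + 1) => N₀) _ hδ (h n N₀ hn) J b hJ i
end Currencies

end Summit.QuantumFields.BalabanUV.Beta.GAN24.GaugeTermKernelCubic

end
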